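import Summits.QuantumFields.YangMills.Theorems.UnitScaleTiltProp7GaugedRowsVacuousAtFlat
import Summits.QuantumFields.YangMills.Theorems.UnitScaleTiltProp7LineFieldZdLetters
import Summits.QuantumFields.YangMills.Theorems.UnitScaleTiltProp7VacuityBlockProfile
import Summits.QuantumFields.YangMills.Theorems.UnitScaleTiltProp7VacuityCompensator
import Summits.QuantumFields.YangMills.Theorems.UnitScaleTiltProp7AxialReprPrint
import HarnessLib

/-!
# Route `UnitScaleTilt`, crux K1 child «MinimiserStabilityRegPr» (stmt-QuantumFields-19200) — **DOOR-VACUITY CERTIFICATE, FILE C-II (FINAL): THE HYPOTHESIS `hQW` OF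
# ✓`Prop7HcoWOfGaugedRows.hcoW_of_gaugedRowsW` IS UNINHABITED — `not_hQW`**

Cell `ym3-torus`, width seat `ym3-torus-px4` (gen 6).  THEOREMS ONLY (0 `def`, 0 `sorry`).  ★★OWNER ym3-torus-plan g29 RULING №16 (5), ★ ym-ust-19200-p1 g17 WORD 21 (b)
GO («file `theorem not_hQW : ¬(hQW-body VERBATIM)`»); LOCATE `ym3-torus-px4/g6/LOCATE-VACUITY-CERT-px4g6.md`.  YM₃ on T³ is a ladder rung (R3), not d = 4, not Clay;
nothing here claims `hcoW`, `hcoS`, E′, EX, the stubs or the crux; `--supports stmt-QuantumFields-19200`, count-neutral.  NEGATIVE knowledge: the door is a TRUE theorem whose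
hypothesis is FALSE — VACUOUS AS A DOOR, the class RULING №16 (2) retired it into; nothing displayed is refuted, no socket moves.

THE WITNESS (★p1 g17 LOCATE v3 «GAUGE HOLE» §0.3 at the flat background).  For any family `F`: `(n, K) = (0, 1)`, `B₁ = 1`, and for EVERY `e₇, c₇ > 0`: `e := e₇`,
`α := min c₇ 1`, `V = W := 1`; the profile `θ` of ✓FILE B-II (`Δ₁²θ` block-constant on `ZMod N`, `N = L·M`, `M = 2Lᵐ`), re-based at `x₀₀ := (basePt F 0 1)_{μ₀}`; the
LONGITUDINAL PURE GAUGE `A⟨x, μ⟩ := [μ = μ₀]·η⁻¹t·(θ(x_{μ₀}+1−x₀₀) − θ(x_{μ₀}−x₀₀))·σ₃` (FILE A's line field), `U₁ := expHermField (η•A) = 1^{w}`, `w(x) = e^{−itθ(x_{μ₀}−x₀₀)σ₃}`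
(§2); `u` := the torus descent (✓`Prop7AxialReprPrint.exists_su_gauge_of_periodic`) of FILE C-I's compensator with corner labels `κ(y) := t·θ(L·y_{μ₀})` (§3).  Clauses:
[C1]∕[C2]∕[C4]∕[C5] ✓FILE A; [C3] ✓`restr129_compensator` through the based pullback; [C6]∕[C7]∕[C8] ✓FILE B-I at `pull A x₀` = the `ℤ³` line field with B-II's lifted profile
((1.38) by ✓`third_difference_eq`); [C9] `(u·w)↓ = 1` + ✓`gaugeAct_mem_regFibrePr_iff_of_trivial`; then ✓FILE A's `rows_false_at_flat`.  Amplitude `t := α∕(32L³(S+1))`, `S := Σ_τ|θ τ|`.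

REMARK (★p1 g17 WORD 21 (b); no second file).  The same datum kills the `hSig`-type hypotheses of ✓p687613∕✓p687961∕✓p688420∕✓p689738 (`hcoW_of_sigmaRowsW[…]`): their rows
imply `hQW`'s HESS row via `hess_arith`, and the HESS row is what fails here (`K(1, A) = 0 < M`).

References: T. Bałaban, CMP 102 (1985) 277–309 [Balaban1985Variational] ((2)–(6) p.278, (15) p.280, (19)–(21) p.281, (141)–(143) p.299); CMP 99 (1985) 75–102
[Balaban1985RegularSpaces] ((1.29) p.81, (1.36)–(1.39) pp.82–83); CMP 98 (1985) 17–51 [Balaban1985Averaging] ((8)–(9) p.19, (78)–(81) p.30).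
-/

set_option autoImplicit false
noncomputable section

open scoped BigOperators Matrix.Norms.L2Operator Matrix Topology
open Filter NormedSpace

namespace Summit.QuantumFields.YangMills.Theorems.Prop7HcoWOfGaugedRowsVacuous

open Literature.MathematicalPhysics.QuantumFieldTheory.Balaban1983to89
open Literature.MathematicalPhysics.QuantumFieldTheory.Balaban1983to89.T3ContinuumYM3Torus
open Literature.MathematicalPhysics.QuantumFieldTheory.Balaban1983to89.T3UnitLawDensityEML (ℰp)
open Literature.MathematicalPhysics.QuantumFieldTheory.Balaban1983to89.T3ConstrainedMinimiser (fibre)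
open Literature.MathematicalPhysics.QuantumFieldTheory.Balaban1983to89.T3PrintedRegularMinimiser
open Literature.MathematicalPhysics.QuantumFieldTheory.Balaban1983to89.T3RegularMinimiser
open Literature.MathematicalPhysics.QuantumFieldTheory.Balaban1983to89.T3PrintedRegularOrbits (descTransf gaugeAct_mem_regFibrePr_iff_of_trivial sites_eq)
open Literature.MathematicalPhysics.QuantumFieldTheory.Balaban1983to89.T3LevelShift (siteShift)
open Literature.MathematicalPhysics.QuantumFieldTheory.Balaban1983to89.B9AdOrthogonal (σ₃)
open T4Continuum BlockAveraging AveragingRT ExpMeanLog BlockAveragingEMLLinearised BlockAveragingEMLLinearisedBackground BlockAveragingEMLProp2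
open B10Eq27TorusAxialLog (pull pull_apply transl transl_apply unitsField toUField suIncl val_suIncl)
open B8Thm2SetupTorus (pullGauge pullGauge_apply toUGauge)
open B7Prop2SpecialUnitary (specialUnitaryUnits)
open B8Eq119TwistedAxial (Restr129)
open B8Thm4TorusAt (torusLam)
open B15DeterminingSets (embIter)
open T3SectALandauChart (emb15 eta eta_pos bgUnits)
open Literature.MathematicalPhysics.QuantumLattice (blockMap blockBase blockMap_blockBase)
open Summit.QuantumFields.YangMills.Theorems.Prop7SPrint (basePt RestrictedPrint)
open Summit.QuantumFields.YangMills.Theorems.Prop7TPrint (expHerm expHermField expHermField_apply coe_expHerm)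
open Summit.QuantumFields.YangMills.Theorems.Prop7AxialReprPrint (embIter_eq_transl exists_su_gauge_of_periodic)
open Summit.QuantumFields.YangMills.Theorems.Prop7FlatHolonomy (transfUp_eq_embIter sitesPerDir_zero_eq_mul_pow)
open Summit.QuantumFields.YangMills.Theorems.Prop7GaugedRowsVacuousAtFlat
open Summit.QuantumFields.YangMills.Theorems.Prop7LineFieldZdLetters (c136T_one_lineField c139T_one_lineField isLandau138_one_lineField)
open Summit.QuantumFields.YangMills.Theorems.Prop7VacuityBlockProfile (exists_blockProfile third_difference_eq)
open Summit.QuantumFields.YangMills.Theorems.Prop7VacuityCompensator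

variable {F : T3Family} {n K : ℕ}

/-! ## §1 The based pullback of the background `1` and of a longitudinal line field -/

/-- The based pullback of the trivial background is the trivial `ℤ³` background (lit ✓`unitsField_toUField_one`). [cite: Balaban1985Averaging, (19) p.21] -/
theorem pull_bgUnits_one (x₀ : Site (F.P K) 0) :
    pull (bgUnits F K (1 : GaugeField (F.P K) 0 (Matrix.specialUnitaryGroup (Fin 2) ℂ))) x₀ = 1 := by
  funext z μ
  rw [pull_apply, bgUnits, unitsField_toUField_one]
  rfl

/-- **The based pullback of FILE A's longitudinal line field is FILE B-I's `ℤ³` line field** with the integer profile `a(m) := c(x₀₀ + m)·σ₃`, `x₀₀ = (x₀)_{μ₀}`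
(`transl x₀ z` moves the coordinate `μ₀` by `z_{μ₀}`). [cite: Balaban1985Averaging, (9) p.18; Balaban1985RegularSpaces, (1.3) p.77] -/
theorem pull_lineField (μ₀ : Fin (F.P K).d) (c : ZMod ((F.P K).sitesPerDir 0) → ℝ)
    {A : PBond (F.P K) 0 → Matrix (Fin 2) (Fin 2) ℂ} (hA : ∀ b, A b = if b.dir = μ₀ then ((c (b.src μ₀) : ℝ) : ℂ) • σ₃ else 0)
    (x₀ : Site (F.P K) 0) (z : B7Prop1Explicit.Site (F.P K).d) (μ : Fin (F.P K).d) :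
    pull A x₀ z μ = if μ = μ₀ then (fun m : ℤ => ((c (x₀ μ₀ + (m : ZMod ((F.P K).sitesPerDir 0))) : ℝ) : ℂ) • σ₃) (z μ₀) else 0 := by
  rw [pull_apply, hA]
  rfl

/-! ## §2 The pure-gauge perturbation: `expHermField (η•A) = 1^{w}` -/

/-- The coordinate `μ₀` of `x + e_{μ₀}` is `x_{μ₀} + 1`. [folklore] -/
theorem shift_apply_self {P : Params} {j : ℕ} (x : Site P j) (μ₀ : Fin P.d) : (x.shift μ₀) μ₀ = x μ₀ + 1 := by
  unfold Site.shift
  exact Function.update_self _ _ _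

/-- ★ **THE LONGITUDINAL PURE GAUGE IS A PURE GAUGE**: with the profile `c(τ) = η⁻¹t·(θ(τ+1−x₀₀) − θ(τ−x₀₀))` of FILE A's line field and the abelian gauge transformation
`w(x) = e^{−itθ(x_{μ₀}−x₀₀)σ₃}`, `expHermField (η•A) = 1^{w}` — bond by bond `e^{it(θ(x_{μ₀}+1−x₀₀) − θ(x_{μ₀}−x₀₀))σ₃} = w(x)·w(x+e_{μ₀})⁻¹`, and `1 = w(x)·w(x+e_ν)⁻¹` across
(`ν ≠ μ₀` does not move `x_{μ₀}`). [cite: Balaban1985Variational, (19) p.281, (4) p.278] -/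
theorem expHermField_eq_gaugeAct (μ₀ : Fin (F.P K).d) (θ : ZMod ((F.P K).sitesPerDir 0) → ℝ) (x₀₀ : ZMod ((F.P K).sitesPerDir 0)) (t : ℝ)
    {A : PBond (F.P K) 0 → Matrix (Fin 2) (Fin 2) ℂ}
    (hA : ∀ b, A b = if b.dir = μ₀ then (((eta F n K)⁻¹ * t * (θ (b.src μ₀ + 1 - x₀₀) - θ (b.src μ₀ - x₀₀)) : ℝ) : ℂ) • σ₃ else 0)
    {w : GaugeTransf (F.P K) 0 (Matrix.specialUnitaryGroup (Fin 2) ℂ)} (hw : ∀ x, w x = expHerm (((-(t * θ (x μ₀ - x₀₀)) : ℝ) : ℂ) • σ₃)) :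
    expHermField (eta F n K • A) = GaugeField.gaugeAct w 1 := by
  have hη : eta F n K ≠ 0 := (eta_pos F n K).ne'
  funext b
  show expHerm ((eta F n K • A) b) = w b.src * (1 : GaugeField (F.P K) 0 (Matrix.specialUnitaryGroup (Fin 2) ℂ)) b * (w b.tgt)⁻¹
  rw [show (1 : GaugeField (F.P K) 0 (Matrix.specialUnitaryGroup (Fin 2) ℂ)) b = 1 from rfl, mul_one, Pi.smul_apply, hA, hw, hw]
  by_cases hb : b.dir = μ₀
  · rw [if_pos hb, show b.tgt = b.src.shift b.dir from rfl, hb, shift_apply_self, expHerm_smul_σ₃_mul_inv, ← Complex.coe_smul, smul_smul,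
      ← Complex.ofReal_mul]
    congr 3
    field_simp
    ring
  · rw [if_neg hb, smul_zero, show b.tgt = b.src.shift b.dir from rfl, shift_apply_of_ne _ hb, mul_inv_cancel, Prop7TPrint.expHerm_zero]

/-! ## §3 The compensator on the torus: descent, (1.29), and the fibre of the gauged competitor -/

/-- **PERIODICITY OF THE COMPENSATOR PATTERN**: the corner indicator, the block label read through `κ(y) = t·θ(L·y_{μ₀})` (`θ` on `ZMod N`, `N = L·M`), hence FILE C-I's
`W♯`, are `N`-periodic in every direction. [cite: Balaban1985RegularSpaces, (1.3) p.77] -/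
theorem compensator_periodic {d L M N : ℕ} [NeZero L] [NeZero N] (hN : N = L * M) (μ₀ : Fin d) (t : ℝ) (θ : ZMod N → ℝ)
    (z : B7Prop1Explicit.Site d) (i : Fin d) :
    (if blockBase L (blockMap L (z + ((N : ℕ) : ℤ) • B7Prop1Explicit.e i)) = z + ((N : ℕ) : ℤ) • B7Prop1Explicit.e i
        then t * θ ((((L : ℤ) * (blockMap L (z + ((N : ℕ) : ℤ) • B7Prop1Explicit.e i)) μ₀ : ℤ)) : ZMod N)
        else -(t * θ ((((L : ℤ) * (blockMap L (z + ((N : ℕ) : ℤ) • B7Prop1Explicit.e i)) μ₀ : ℤ)) : ZMod N)) / ((L : ℝ) ^ d - 1) : ℝ)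
      = (if blockBase L (blockMap L z) = z then t * θ ((((L : ℤ) * (blockMap L z) μ₀ : ℤ)) : ZMod N)
          else -(t * θ ((((L : ℤ) * (blockMap L z) μ₀ : ℤ)) : ZMod N)) / ((L : ℝ) ^ d - 1) : ℝ) := by
  have hL0 : (L : ℤ) ≠ 0 := by exact_mod_cast NeZero.ne L
  have hbm : blockMap L (z + ((N : ℕ) : ℤ) • B7Prop1Explicit.e i) = blockMap L z + ((M : ℕ) : ℤ) • B7Prop1Explicit.e i := by
    funext j
    simp only [blockMap, Pi.add_apply, Pi.smul_apply, smul_eq_mul]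
    rw [hN, Nat.cast_mul, show (L : ℤ) * (M : ℤ) * B7Prop1Explicit.e i j = (L : ℤ) * ((M : ℤ) * B7Prop1Explicit.e i j) by ring,
      Int.add_mul_ediv_left _ _ hL0]
  have hbb : blockBase L (blockMap L z + ((M : ℕ) : ℤ) • B7Prop1Explicit.e i) = blockBase L (blockMap L z) + ((N : ℕ) : ℤ) • B7Prop1Explicit.e i := by
    funext j
    simp only [blockBase, Pi.add_apply, Pi.smul_apply, smul_eq_mul, hN, Nat.cast_mul]
    ring
  have hκ : θ ((((L : ℤ) * (blockMap L z + ((M : ℕ) : ℤ) • B7Prop1Explicit.e i) μ₀ : ℤ)) : ZMod N) = θ ((((L : ℤ) * (blockMap L z) μ₀ : ℤ)) : ZMod N) := by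
    congr 1
    simp only [Pi.add_apply, Pi.smul_apply, smul_eq_mul]
    have e1 : ((L : ℤ) * (blockMap L z μ₀ + ((M : ℕ) : ℤ) * B7Prop1Explicit.e i μ₀) : ℤ) = (L : ℤ) * blockMap L z μ₀ + ((N : ℕ) : ℤ) * B7Prop1Explicit.e i μ₀ := by
      rw [hN]; push_cast; ring
    rw [e1]
    push_cast
    rw [ZMod.natCast_self, zero_mul, add_zero]
  rw [hbm, hbb, hκ]
  simp only [add_left_inj]

/-- Every 1-centre of the run `(n, K) = (0, 1)` is `x₀ + L·ỹ`, `x₀ = basePt F 0 1` (✓`embIter_eq_transl`). [cite: Balaban1987RG1, (0.1) p.251] -/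
theorem embIter_one_eq_transl (y : Site (F.P 1) (1 - 0)) :
    embIter (1 - 0) y = transl (basePt F 0 1) ((((F.P 1).L : ℤ) ^ (1 - 0)) • fun μ => ((y μ).val : ℤ)) :=
  embIter_eq_transl (P := F.P 1) (k := 1 - 0) (by show 1 - 0 ≤ F.m + 1; omega) y

/-! ## §4 `hQW` is uninhabited -/

set_option maxHeartbeats 400000 in
/-- ★★★ **THE HYPOTHESIS `hQW` OF ✓`Prop7HcoWOfGaugedRows.hcoW_of_gaugedRowsW` IS FALSE** (its body VERBATIM under `¬`): at `L := F.L`, `B₁ := 1`, for every `e₇, c₇ > 0` the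
flat longitudinal pure-gauge datum of the module docstring meets every clause [C1]–[C9] of the binder at `(n, K) = (0, 1)`, `e = e₇`, `α = min c₇ 1`, and ✓FILE A's
`rows_false_at_flat` refutes the rows.  So the door is VACUOUS AS A DOOR (RULING №16 (2)), now by kernel.
[cite: Balaban1985Variational, (141)-(143) p.299, (19)-(21) p.281, (2)-(6) p.278; Balaban1985RegularSpaces, (1.29) p.81, (1.36)-(1.39) pp.82-83] -/
theorem not_hQW (F : T3Family) : ¬ (∀ (L : ℕ), 1 < L → ∀ (B₁ : ℝ), 0 < B₁ → ∃ e₇ c₇ : ℝ, 0 < e₇ ∧ 0 < c₇ ∧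
      ∀ (F : T3Family), F.L = L → ∀ (n K : ℕ) (hnK : n < K) (e α : ℝ) (V : GaugeField (F.P n) 0 (Matrix.specialUnitaryGroup (Fin 2) ℂ))
        (W U₁ : GaugeField (F.P K) 0 (Matrix.specialUnitaryGroup (Fin 2) ℂ)) (u : GaugeTransf (F.P K) 0 (Matrix.specialUnitaryGroup (Fin 2) ℂ))
        (A : PBond (F.P K) 0 → Matrix (Fin 2) (Fin 2) ℂ),
        0 < e → e ≤ e₇ → 0 < α → α ≤ c₇ → W ∈ regFibrePr F n K hnK.le e V →
        (∀ γ : ℝ → GaugeField (F.P K) 0 (Matrix.specialUnitaryGroup (Fin 2) ℂ), γ 0 = W → (∀ t, γ t ∈ fibre F ℰp n K hnK.le V) →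
          (∀ b, DifferentiableAt ℝ (fun t => ((γ t b : Matrix.specialUnitaryGroup (Fin 2) ℂ) : Matrix (Fin 2) (Fin 2) ℂ)) 0) →
            deriv (fun t => wilsonAction4 (γ t)) 0 = 0) →
        RestrictedPrint F n K W u → (∀ b : PBond (F.P K) 0, IsSelfAdjoint (A b)) →
        (∀ b : PBond (F.P K) 0, ((U₁ b : Matrix.specialUnitaryGroup (Fin 2) ℂ) : Matrix (Fin 2) (Fin 2) ℂ) = exp (Complex.I • ((eta F n K) • A b))) →
        (∃ (β₀ B₂ : ℝ) (len : B7Prop1Explicit.Site (F.P K).d → ℝ),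
          B8Thm2TorusAt.C136T (F.P K).L (K - n) (eta F n K) β₀ B₁ B₂ len α (pull (bgUnits F K W) (basePt F n K)) (pull A (basePt F n K))) →
        B8Eq138LandauZd.IsLandau138 (F.P K).L (K - n) (eta F n K) (Set.univ : Set (B7Prop1Explicit.Site (F.P K).d)) (B8Thm4TorusAt.torusLam (K - n))
          (pull (bgUnits F K W) (basePt F n K)) (pull A (basePt F n K)) →
        B8Thm2TorusAt.C139T (F.P K).L (K - n) (eta F n K) B₁ α (pull (bgUnits F K W) (basePt F n K)) (pull A (basePt F n K)) →
        GaugeField.gaugeAct u (emb15 W U₁) ∈ regFibrePr F n K hnK.le e V →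
          ∃ s κ C₁ C₂ : ℝ, (∀ b : PBond (F.P K) 0, ‖(eta F n K • A) b‖ ≤ s) ∧ 4 * s ≤ 1 ∧
            κ * ∑ b : PBond (F.P K) 0, ‖(eta F n K • A) b‖ ^ 2 ≤ ∑ p : Plaq (F.P K) 0, ‖((Complex.I • (eta F n K • A) ⟨p.src, p.μ⟩) + ((W ⟨p.src, p.μ⟩ : Matrix (Fin 2) (Fin 2) ℂ) * (Complex.I • (eta F n K • A) ⟨p.src.shift p.μ, p.ν⟩) * star (W ⟨p.src, p.μ⟩ : Matrix (Fin 2) (Fin 2) ℂ))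
            - (((W ⟨p.src, p.μ⟩ * W ⟨p.src.shift p.μ, p.ν⟩ * (W ⟨p.src.shift p.ν, p.μ⟩)⁻¹ : Matrix.specialUnitaryGroup (Fin 2) ℂ) : Matrix (Fin 2) (Fin 2) ℂ) * (Complex.I • (eta F n K • A) ⟨p.src.shift p.ν, p.μ⟩) * star ((W ⟨p.src, p.μ⟩ * W ⟨p.src.shift p.μ, p.ν⟩ * (W ⟨p.src.shift p.ν, p.μ⟩)⁻¹ : Matrix.specialUnitaryGroup (Fin 2) ℂ) : Matrix (Fin 2) (Fin 2) ℂ))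
            - (((GaugeField.plaqHol W p : Matrix.specialUnitaryGroup (Fin 2) ℂ) : Matrix (Fin 2) (Fin 2) ℂ) * (Complex.I • (eta F n K • A) ⟨p.src, p.ν⟩) * star ((GaugeField.plaqHol W p : Matrix.specialUnitaryGroup (Fin 2) ℂ) : Matrix (Fin 2) (Fin 2) ℂ)))‖ ^ 2 ∧
            (∀ (Q : (k : ℕ) → (PBond (F.P K) 0 → Matrix (Fin 2) (Fin 2) ℂ) → PBond (F.P K) k → Matrix (Fin 2) (Fin 2) ℂ), (∀ Y, Q 0 Y = Y) →
        (∀ (k : ℕ) (Y : PBond (F.P K) 0 → Matrix (Fin 2) (Fin 2) ℂ) (c : PBond (F.P K) (k + 1)), Q (k + 1) Y c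
          = fderiv ℂ (eml : (Idx (F.P K) → Matrix (Fin 2) (Fin 2) ℂ) → Matrix (Fin 2) (Fin 2) ℂ)
              (fun i => ((loopHol (Averaging.iter (fun i => blockAvg (P := F.P K) (j := i) (expMeanLogSU (n := Fin 2))) k W) c i :
                Matrix.specialUnitaryGroup (Fin 2) ℂ) : Matrix (Fin 2) (Fin 2) ℂ))
              (fun i => covWalkSum (Averaging.iter (fun i => blockAvg (P := F.P K) (j := i) (expMeanLogSU (n := Fin 2))) k W) (Q k Y)
                  (walk (emb c.src) (loopWord (F.P K).L c.dir (off i.1) i.2.1 i.2.2))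
                * ((loopHol (Averaging.iter (fun i => blockAvg (P := F.P K) (j := i) (expMeanLogSU (n := Fin 2))) k W) c i :
                  Matrix.specialUnitaryGroup (Fin 2) ℂ) : Matrix (Fin 2) (Fin 2) ℂ))
              * star ((corr (expMeanLogSU (n := Fin 2)) (Averaging.iter (fun i => blockAvg (P := F.P K) (j := i) (expMeanLogSU (n := Fin 2))) k W) c :
                  Matrix.specialUnitaryGroup (Fin 2) ℂ) : Matrix (Fin 2) (Fin 2) ℂ)
            + ((corr (expMeanLogSU (n := Fin 2)) (Averaging.iter (fun i => blockAvg (P := F.P K) (j := i) (expMeanLogSU (n := Fin 2))) k W) c :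
                  Matrix.specialUnitaryGroup (Fin 2) ℂ) : Matrix (Fin 2) (Fin 2) ℂ)
              * covWalkSum (Averaging.iter (fun i => blockAvg (P := F.P K) (j := i) (expMeanLogSU (n := Fin 2))) k W) (Q k Y)
                  (walk (emb c.src) (List.replicate (F.P K).L (c.dir, true)))
              * star ((corr (expMeanLogSU (n := Fin 2)) (Averaging.iter (fun i => blockAvg (P := F.P K) (j := i) (expMeanLogSU (n := Fin 2))) k W) c :
                  Matrix.specialUnitaryGroup (Fin 2) ℂ) : Matrix (Fin 2) (Fin 2) ℂ)) →
            ∃ μ : Site (F.P K) (K - n) → Matrix (Fin 2) (Fin 2) ℂ, (∀ y, μ y ∈ skewAdjoint (Matrix (Fin 2) (Fin 2) ℂ) ∧ (μ y).trace = 0) ∧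
            ∑ c : PBond (F.P K) (K - n), ‖Q (K - n) (fun b => Complex.I • (eta F n K • A) b) c
                - (μ c.src
                  - ((Averaging.iter (fun i => blockAvg (P := F.P K) (j := i) (expMeanLogSU (n := Fin 2))) (K - n) W c : Matrix.specialUnitaryGroup (Fin 2) ℂ) :
                      Matrix (Fin 2) (Fin 2) ℂ) * μ c.tgt
                    * star ((Averaging.iter (fun i => blockAvg (P := F.P K) (j := i) (expMeanLogSU (n := Fin 2))) (K - n) W c : Matrix.specialUnitaryGroup (Fin 2) ℂ) :
                      Matrix (Fin 2) (Fin 2) ℂ))‖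
              ≤ C₁ * ((F.L : ℝ) ^ (K - n))⁻¹ * ∑ b : PBond (F.P K) 0, ‖(eta F n K • A) b‖ ^ 2
                + C₂ * (F.L : ℝ) ^ (K - n) * ∑ p : Plaq (F.P K) 0, ‖((Complex.I • (eta F n K • A) ⟨p.src, p.μ⟩) + ((W ⟨p.src, p.μ⟩ : Matrix (Fin 2) (Fin 2) ℂ) * (Complex.I • (eta F n K • A) ⟨p.src.shift p.μ, p.ν⟩) * star (W ⟨p.src, p.μ⟩ : Matrix (Fin 2) (Fin 2) ℂ))
            - (((W ⟨p.src, p.μ⟩ * W ⟨p.src.shift p.μ, p.ν⟩ * (W ⟨p.src.shift p.ν, p.μ⟩)⁻¹ : Matrix.specialUnitaryGroup (Fin 2) ℂ) : Matrix (Fin 2) (Fin 2) ℂ) * (Complex.I • (eta F n K • A) ⟨p.src.shift p.ν, p.μ⟩) * star ((W ⟨p.src, p.μ⟩ * W ⟨p.src.shift p.μ, p.ν⟩ * (W ⟨p.src.shift p.ν, p.μ⟩)⁻¹ : Matrix.specialUnitaryGroup (Fin 2) ℂ) : Matrix (Fin 2) (Fin 2) ℂ))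
            - (((GaugeField.plaqHol W p : Matrix.specialUnitaryGroup (Fin 2) ℂ) : Matrix (Fin 2) (Fin 2) ℂ) * (Complex.I • (eta F n K • A) ⟨p.src, p.ν⟩) * star ((GaugeField.plaqHol W p : Matrix.specialUnitaryGroup (Fin 2) ℂ) : Matrix (Fin 2) (Fin 2) ℂ)))‖ ^ 2) ∧
            2 * e * C₂ ≤ 1 / 8 ∧
            2 * e * C₁ * (((F.L : ℝ) ^ (K - n)) ^ 2)⁻¹ + 15552 * s ^ 2 + 216 * regThreshold F n K e ≤ κ / 8) := by
  intro H
  classical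
  -- ### the run `(n, K) = (0, 1)` and its sizes
  have hL1 : 1 < F.L := F.hL.2
  obtain ⟨e₇, c₇, he₇, hc₇, H⟩ := H F.L hL1 1 one_pos
  have hLF : (F.P 1).L = F.L := rfl
  have hL2 : 2 ≤ (F.P 1).L := by rw [hLF]; omega
  have hL0 : 0 < (F.P 1).L := by omega
  haveI : NeZero (F.P 1).L := ⟨by omega⟩
  have hd3 : (F.P 1).d = 3 := rfl
  have hN : (F.P 1).sitesPerDir 0 = (F.P 1).L * (F.P 1).sitesPerDir 1 := by
    rw [sitesPerDir_zero_eq_mul_pow (P := F.P 1) (k := 1) (by show 1 ≤ F.m + 1; omega), pow_one, mul_comm]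
  have hM : 1 < (F.P 1).sitesPerDir 1 := by
    show 1 < 2 * (F.P 1).L ^ ((F.P 1).m + (F.P 1).K - 1)
    have : 1 ≤ (F.P 1).L ^ ((F.P 1).m + (F.P 1).K - 1) := Nat.one_le_pow _ _ hL0
    omega
  have hLpos : (0 : ℝ) < (F.L : ℝ) := by exact_mod_cast (by omega : 0 < F.L)
  have hL1r : (1 : ℝ) ≤ (F.L : ℝ) := by exact_mod_cast hL1.le
  -- ### the profile on the cycle (FILE B-II)
  obtain ⟨θ, φ, g, C, hθ, hφ, hg, τ₀, hτ₀⟩ := exists_blockProfile (N := (F.P 1).sitesPerDir 0) hN hL0 hM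
  -- ### letters
  let μ₀ : Fin (F.P 1).d := ⟨0, by rw [hd3]; norm_num⟩
  let x₀₀ : ZMod ((F.P 1).sitesPerDir 0) := (basePt F 0 1) μ₀
  have hη : 0 < eta F 0 1 := eta_pos F 0 1
  have hηL : eta F 0 1 = (F.L : ℝ)⁻¹ := by show ((F.L : ℝ)⁻¹) ^ (1 - 0) = _; rw [pow_one]
  have hηinv : (eta F 0 1)⁻¹ = F.L := by rw [hηL, inv_inv]
  have hnη : ‖(eta F 0 1)⁻¹‖ = F.L := by rw [hηinv, Real.norm_eq_abs, abs_of_pos hLpos]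
  -- ### amplitude
  let S₀ : ℝ := ∑ τ, |θ τ|
  have hS₀ : ∀ τ, |θ τ| ≤ S₀ := fun τ => Finset.single_le_sum (f := fun τ => |θ τ|) (fun τ _ => abs_nonneg (θ τ)) (Finset.mem_univ τ)
  have hS₀nn : 0 ≤ S₀ := Finset.sum_nonneg fun τ _ => abs_nonneg (θ τ)
  let α : ℝ := min c₇ 1
  have hα : 0 < α := lt_min hc₇ one_pos
  have hαc : α ≤ c₇ := min_le_left _ _
  have hα1 : α ≤ 1 := min_le_right _ _
  let t : ℝ := α / (32 * (F.L : ℝ) ^ 3 * (S₀ + 1))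
  have ht : 0 < t := by positivity
  have htS : t * S₀ ≤ 1 / 32 := by
    have h32 : (0 : ℝ) < 32 * (F.L : ℝ) ^ 3 * (S₀ + 1) := by positivity
    have hL3 : (1 : ℝ) ≤ (F.L : ℝ) ^ 3 := one_le_pow₀ hL1r
    rw [show t * S₀ = α * S₀ / (32 * (F.L : ℝ) ^ 3 * (S₀ + 1)) by simp only [t]; ring, div_le_iff₀ h32]
    nlinarith [mul_nonneg hα.le hS₀nn]
  -- the bound `B := η⁻¹·t·2S₀` and the four smallness inequalities of FILE B-I
  have hB4 : (F.L : ℝ) * ((F.L : ℝ) * (4 * ((eta F 0 1)⁻¹ * t * (2 * S₀)))) < 1 * α := by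
    rw [hηinv, one_mul]
    have h32 : (0 : ℝ) < 32 * (F.L : ℝ) ^ 3 * (S₀ + 1) := by positivity
    have e1 : (F.L : ℝ) * ((F.L : ℝ) * (4 * ((F.L : ℝ) * t * (2 * S₀)))) = α * S₀ / (4 * (S₀ + 1)) := by
      simp only [t]; field_simp; ring
    rw [e1, div_lt_iff₀ (by positivity)]
    nlinarith [mul_nonneg hα.le hS₀nn]
  have hBnn : 0 ≤ (eta F 0 1)⁻¹ * t * (2 * S₀) := by rw [hηinv]; positivity
  have h3 : ‖(eta F 0 1)⁻¹‖ * (4 * ((eta F 0 1)⁻¹ * t * (2 * S₀))) < 1 * α := by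
    rw [hnη]
    calc (F.L : ℝ) * (4 * ((eta F 0 1)⁻¹ * t * (2 * S₀))) = 1 * ((F.L : ℝ) * (4 * ((eta F 0 1)⁻¹ * t * (2 * S₀)))) := (one_mul _).symm
      _ ≤ (F.L : ℝ) * ((F.L : ℝ) * (4 * ((eta F 0 1)⁻¹ * t * (2 * S₀)))) := mul_le_mul_of_nonneg_right hL1r (by positivity)
      _ < 1 * α := hB4
  have h4 : ‖(eta F 0 1)⁻¹‖ * (‖(eta F 0 1)⁻¹‖ * (4 * ((eta F 0 1)⁻¹ * t * (2 * S₀)))) < 1 * α := by rw [hnη]; exact hB4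
  have h2 : ‖(eta F 0 1)⁻¹‖ * (2 * ((eta F 0 1)⁻¹ * t * (2 * S₀))) < 1 * α :=
    lt_of_le_of_lt (mul_le_mul_of_nonneg_left (by nlinarith [hBnn]) (norm_nonneg _)) h3
  have h1 : (eta F 0 1)⁻¹ * t * (2 * S₀) < 1 * α := by
    calc (eta F 0 1)⁻¹ * t * (2 * S₀) ≤ ‖(eta F 0 1)⁻¹‖ * (4 * ((eta F 0 1)⁻¹ * t * (2 * S₀))) := by rw [hnη]; nlinarith [hBnn, hL1r]
      _ < 1 * α := h3
  -- ### the torus datum: profile, line field, pure gauge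
  let c : ZMod ((F.P 1).sitesPerDir 0) → ℝ := fun τ => (eta F 0 1)⁻¹ * t * (θ (τ + 1 - x₀₀) - θ (τ - x₀₀))
  let A : PBond (F.P 1) 0 → Matrix (Fin 2) (Fin 2) ℂ := fun b => if b.dir = μ₀ then ((c (b.src μ₀) : ℝ) : ℂ) • σ₃ else 0
  have hA : ∀ b, A b = if b.dir = μ₀ then ((c (b.src μ₀) : ℝ) : ℂ) • σ₃ else 0 := fun b => rfl
  have hA' : ∀ b, A b = if b.dir = μ₀ then (((eta F 0 1)⁻¹ * t * (θ (b.src μ₀ + 1 - x₀₀) - θ (b.src μ₀ - x₀₀)) : ℝ) : ℂ) • σ₃ else 0 := fun b => rfl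
  let w : GaugeTransf (F.P 1) 0 (Matrix.specialUnitaryGroup (Fin 2) ℂ) := fun x => expHerm (((-(t * θ (x μ₀ - x₀₀)) : ℝ) : ℂ) • σ₃)
  have hw : ∀ x, w x = expHerm (((-(t * θ (x μ₀ - x₀₀)) : ℝ) : ℂ) • σ₃) := fun x => rfl
  have hU₁w : expHermField (eta F 0 1 • A) = GaugeField.gaugeAct w 1 := expHermField_eq_gaugeAct μ₀ θ x₀₀ t hA' hw
  -- ### the compensator on `ℤ³` (FILE C-I) and its torus descent
  let kap : B7Prop1Explicit.Site (F.P 1).d → ℝ := fun y => t * θ (((((F.P 1).L : ℤ) * y μ₀ : ℤ)) : ZMod ((F.P 1).sitesPerDir 0))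
  let ρ : B7Prop1Explicit.Site (F.P 1).d → ℝ := fun z =>
    if blockBase (F.P 1).L (blockMap (F.P 1).L z) = z then kap (blockMap (F.P 1).L z) else -kap (blockMap (F.P 1).L z) / (((F.P 1).L : ℝ) ^ (F.P 1).d - 1)
  let Wc : B7Prop1Explicit.Site (F.P 1).d → (Matrix (Fin 2) (Fin 2) ℂ)ˣ := fun z => Unitary.toUnits (suIncl (expHerm (((ρ z : ℝ) : ℂ) • σ₃)))
  have hWc : ∀ z, ((Wc z : (Matrix (Fin 2) (Fin 2) ℂ)ˣ) : Matrix (Fin 2) (Fin 2) ℂ) =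
      exp ((Complex.I * (((if blockBase (F.P 1).L (blockMap (F.P 1).L z) = z then kap (blockMap (F.P 1).L z)
        else -kap (blockMap (F.P 1).L z) / (((F.P 1).L : ℝ) ^ (F.P 1).d - 1) : ℝ)) : ℂ)) • σ₃) := fun z => by
    show (((suIncl (expHerm (((ρ z : ℝ) : ℂ) • σ₃))) : Matrix.unitaryGroup (Fin 2) ℂ) : Matrix (Fin 2) (Fin 2) ℂ) = _
    rw [val_suIncl, coe_expHerm_real_smul_σ₃]
  have hkap : ∀ y, |kap y| ≤ 1 / 20 := fun y => by
    show |t * θ _| ≤ 1 / 20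
    rw [abs_mul, abs_of_pos ht]
    calc t * |θ _| ≤ t * S₀ := mul_le_mul_of_nonneg_left (hS₀ _) ht.le
      _ ≤ 1 / 32 := htS
      _ ≤ 1 / 20 := by norm_num
  have hWmem : ∀ z, Wc z ∈ specialUnitaryUnits (Fin 2) := compensator_mem_specialUnitaryUnits kap hWc
  have hper : ∀ (z : B7Prop1Explicit.Site (F.P 1).d) (i : Fin (F.P 1).d), Wc (z + (((F.P 1).sitesPerDir 0 : ℕ) : ℤ) • B7Prop1Explicit.e i) = Wc z :=
    fun z i => by
    show Unitary.toUnits (suIncl (expHerm (((ρ (z + (((F.P 1).sitesPerDir 0 : ℕ) : ℤ) • B7Prop1Explicit.e i) : ℝ) : ℂ) • σ₃)))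
      = Unitary.toUnits (suIncl (expHerm (((ρ z : ℝ) : ℂ) • σ₃)))
    rw [show ρ (z + (((F.P 1).sitesPerDir 0 : ℕ) : ℤ) • B7Prop1Explicit.e i) = ρ z from
      compensator_periodic hN μ₀ t θ z i]
  obtain ⟨v, hv⟩ := exists_su_gauge_of_periodic (P := F.P 1) (N := 2) hWmem hper (basePt F 0 1)
  -- ### [C3]: the restriction (1.29) for `v`, read on `ℤ³`
  have hpb1 : pull (unitsField (toUField (1 : GaugeField (F.P 1) 0 (Matrix.specialUnitaryGroup (Fin 2) ℂ)))) (basePt F 0 1) = 1 :=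
    pull_bgUnits_one (F := F) (K := 1) (basePt F 0 1)
  have hC3 : RestrictedPrint F 0 1 1 v := by
    unfold RestrictedPrint
    rw [hv, hpb1]
    exact restr129_compensator (by rw [hd3]; norm_num) hL2 kap hWc hkap
  -- ### [C9]: the gauged competitor is on the regular fibre of `V = 1` (`(v·w)↓ = 1`)
  have hcentre : ∀ y : Site (F.P 1) (1 - 0), v (embIter (1 - 0) y) * w (embIter (1 - 0) y) = 1 := by
    intro y
    rw [embIter_one_eq_transl]
    have hz : ((((F.P 1).L : ℤ) ^ (1 - 0)) • fun μ => (((y μ).val : ℤ))) = blockBase (F.P 1).L (fun μ => (((y μ).val : ℤ))) := by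
      funext j; simp only [Pi.smul_apply, smul_eq_mul, blockBase, Nat.sub_zero, pow_one]
    rw [hz]
    set yt : B7Prop1Explicit.Site (F.P 1).d := fun μ => (((y μ).val : ℤ)) with hyt
    -- `v` at the corner `x₀ + L·ỹ` is `expHerm (κ(ỹ)σ₃)`
    have hvz : v (transl (basePt F 0 1) (blockBase (F.P 1).L yt)) = expHerm (((kap yt : ℝ) : ℂ) • σ₃) := by
      have e := congrArg (fun u : (Matrix (Fin 2) (Fin 2) ℂ)ˣ => (u : Matrix (Fin 2) (Fin 2) ℂ)) (congrFun hv (blockBase (F.P 1).L yt))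
      simp only [pullGauge_apply, Unitary.val_toUnits_apply, B8Thm2SetupTorus.toUGauge_apply, val_suIncl] at e
      apply Subtype.ext
      rw [e]
      show ((expHerm (((ρ (blockBase (F.P 1).L yt) : ℝ) : ℂ) • σ₃) : Matrix.specialUnitaryGroup (Fin 2) ℂ) : Matrix (Fin 2) (Fin 2) ℂ) = _
      rw [show ρ (blockBase (F.P 1).L yt) = kap yt by simp only [ρ, blockMap_blockBase, if_true]]
    -- `w` at the corner is `expHerm (−κ(ỹ)σ₃)`
    have hwz : w (transl (basePt F 0 1) (blockBase (F.P 1).L yt)) = expHerm (((-kap yt : ℝ) : ℂ) • σ₃) := by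
      rw [hw]
      congr 3
      show -(t * θ (transl (basePt F 0 1) (blockBase (F.P 1).L yt) μ₀ - x₀₀)) = -(t * θ _)
      rw [transl_apply]
      congr 3
      show (basePt F 0 1) μ₀ + ((blockBase (F.P 1).L yt μ₀ : ℤ) : ZMod ((F.P 1).sitesPerDir 0)) - (basePt F 0 1) μ₀ = _
      rw [add_sub_cancel_left]
      rfl
    rw [hvz, hwz, expHerm_smul_σ₃_mul, add_neg_cancel, Complex.ofReal_zero, zero_smul, Prop7TPrint.expHerm_zero]
  have hdesc : descTransf F 0 1 (Nat.zero_lt_one).le (fun x => v x * w x) = fun _ => 1 := by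
    funext x; unfold descTransf; rw [transfUp_eq_embIter]; exact hcentre _
  have hC9 : GaugeField.gaugeAct v (emb15 1 (expHermField (eta F 0 1 • A))) ∈ regFibrePr F 0 1 (Nat.zero_lt_one).le e₇ 1 := by
    rw [emb15_one_left, hU₁w, T3UnitLawGaugeInvariance.gaugeAct_gaugeAct]
    exact (gaugeAct_mem_regFibrePr_iff_of_trivial F _ he₇.le hdesc 1 1).mpr (one_mem_regFibrePr _ he₇)
  -- ### [C6][C7][C8]: the print clauses at the based pullback (FILES B-I, B-II)
  have hpb : pull (bgUnits F 1 (1 : GaugeField (F.P 1) 0 (Matrix.specialUnitaryGroup (Fin 2) ℂ))) (basePt F 0 1) = 1 := pull_bgUnits_one _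
  let a : ℤ → Matrix (Fin 2) (Fin 2) ℂ := fun m => ((c (x₀₀ + (m : ZMod ((F.P 1).sitesPerDir 0))) : ℝ) : ℂ) • σ₃
  have hAp : ∀ z μ, pull A (basePt F 0 1) z μ = if μ = μ₀ then a (z μ₀) else 0 := fun z μ => pull_lineField μ₀ c hA _ z μ
  have hBa : ∀ m, ‖a m‖ ≤ (eta F 0 1)⁻¹ * t * (2 * S₀) := fun m => by
    show ‖((c (x₀₀ + (m : ZMod ((F.P 1).sitesPerDir 0))) : ℝ) : ℂ) • σ₃‖ ≤ _
    rw [norm_smul, norm_σ₃, mul_one, Complex.norm_real, Real.norm_eq_abs]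
    show |(eta F 0 1)⁻¹ * t * (θ _ - θ _)| ≤ _
    rw [abs_mul, abs_mul, abs_of_pos (inv_pos.mpr hη), abs_of_pos ht]
    refine mul_le_mul_of_nonneg_left ?_ (by rw [hηinv]; positivity)
    exact (abs_sub _ _).trans (by
      linarith [hS₀ (x₀₀ + (m : ZMod ((F.P 1).sitesPerDir 0)) + 1 - x₀₀), hS₀ (x₀₀ + (m : ZMod ((F.P 1).sitesPerDir 0)) - x₀₀)])
  have hη1 : ∀ j, j ≤ 1 - 0 → (1 : ℝ) ≤ (((F.P 1).L : ℝ) ^ j * eta F 0 1)⁻¹ := by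
    intro j hj
    have hj1 : j ≤ 1 := hj
    interval_cases j
    · rw [pow_zero, one_mul, hηinv]; exact hL1r
    · rw [pow_one, hLF, hηL, mul_inv_cancel₀ hLpos.ne', inv_one]
  have hC6 : ∃ (β₀ B₂ : ℝ) (len : B7Prop1Explicit.Site (F.P 1).d → ℝ),
      B8Thm2TorusAt.C136T (F.P 1).L (1 - 0) (eta F 0 1) β₀ 1 B₂ len α (pull (bgUnits F 1 (1 : GaugeField (F.P 1) 0 (Matrix.specialUnitaryGroup (Fin 2) ℂ))) (basePt F 0 1))
        (pull A (basePt F 0 1)) := by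
    refine ⟨0, 1, fun _ => 1, ?_⟩
    rw [hpb]
    exact c136T_one_lineField μ₀ a hAp hBa hη1 _ h1 h2 h3
  have hC8 : B8Thm2TorusAt.C139T (F.P 1).L (1 - 0) (eta F 0 1) 1 α (pull (bgUnits F 1 (1 : GaugeField (F.P 1) 0 (Matrix.specialUnitaryGroup (Fin 2) ℂ))) (basePt F 0 1))
      (pull A (basePt F 0 1)) := by
    rw [hpb]
    exact c139T_one_lineField μ₀ a hAp hBa hη1 h1 h4
  have ha' : ∀ m : ℤ, a m = (((-((eta F 0 1)⁻¹ * t)) * (θ (m : ZMod ((F.P 1).sitesPerDir 0)) - θ ((m : ZMod ((F.P 1).sitesPerDir 0)) + 1)) : ℝ) : ℂ) • σ₃ :=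
    fun m => by
    show ((c (x₀₀ + (m : ZMod ((F.P 1).sitesPerDir 0))) : ℝ) : ℂ) • σ₃ = _
    congr 2
    show (eta F 0 1)⁻¹ * t * (θ (x₀₀ + (m : ZMod ((F.P 1).sitesPerDir 0)) + 1 - x₀₀) - θ (x₀₀ + (m : ZMod ((F.P 1).sitesPerDir 0)) - x₀₀)) = _
    rw [show x₀₀ + (m : ZMod ((F.P 1).sitesPerDir 0)) + 1 - x₀₀ = (m : ZMod ((F.P 1).sitesPerDir 0)) + 1 by ring,
      show x₀₀ + (m : ZMod ((F.P 1).sitesPerDir 0)) - x₀₀ = (m : ZMod ((F.P 1).sitesPerDir 0)) by ring]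
    ring
  have hC7 : B8Eq138LandauZd.IsLandau138 (F.P 1).L (1 - 0) (eta F 0 1) (Set.univ : Set (B7Prop1Explicit.Site (F.P 1).d)) (torusLam (1 - 0))
      (pull (bgUnits F 1 (1 : GaugeField (F.P 1) 0 (Matrix.specialUnitaryGroup (Fin 2) ℂ))) (basePt F 0 1)) (pull A (basePt F 0 1)) := by
    rw [hpb]
    exact isLandau138_one_lineField μ₀ a hAp hL0
      (fun q : ℤ => ((-((-((eta F 0 1)⁻¹ * t)) * ((fun q' : ZMod ((F.P 1).sitesPerDir 1) => if q' = 0 then (1 : ℝ) else 0)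
        ((q : ℤ) : ZMod ((F.P 1).sitesPerDir 1)) - C)) : ℝ) : ℂ) • σ₃)
      (fun m => third_difference_eq σ₃ (-((eta F 0 1)⁻¹ * t)) hN hL0 hθ hφ (fun q' => if q' = 0 then (1 : ℝ) else 0) C hg ha' m)
  -- ### the door's hypothesis at the datum, and the contradiction (FILE A)
  obtain ⟨s, κ, C₁, C₂, -, -, hq, hJ, -, hw₂⟩ := H F rfl 0 1 Nat.zero_lt_one e₇ α 1 1 (expHermField (eta F 0 1 • A)) v A he₇ le_rfl hα hαc
    (one_mem_regFibrePr _ he₇) (fun γ hγ0 _ _ => deriv_wilsonAction4_comp_eq_zero_of_apply_zero γ hγ0) hC3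
    (isSelfAdjoint_of_lineField μ₀ c hA) (coe_expHermField_eta_smul_lineField μ₀ c hA) hC6 hC7 hC8 hC9
  have hc : ∃ τ, c τ ≠ 0 := ⟨τ₀ + x₀₀, by
    show (eta F 0 1)⁻¹ * t * (θ (τ₀ + x₀₀ + 1 - x₀₀) - θ (τ₀ + x₀₀ - x₀₀)) ≠ 0
    rw [show τ₀ + x₀₀ + 1 - x₀₀ = τ₀ + 1 by ring, show τ₀ + x₀₀ - x₀₀ = τ₀ by ring]
    exact mul_ne_zero (mul_ne_zero (inv_ne_zero hη.ne') ht.ne') (sub_ne_zero.mpr hτ₀)⟩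
  exact rows_false_at_flat μ₀ c hc hA rfl he₇ hq hJ hw₂

end Summit.QuantumFields.YangMills.Theorems.Prop7HcoWOfGaugedRowsVacuous

end
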